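import Literature.MathematicalPhysics.QuantumLattice.GrassmannKernelYoung
import Literature.Probability.LatticeModels.SubmultiplicativeTreeWeight
import HarnessLib

/-!
# Young's inequality for the DECAY-WEIGHTED `L¹–L^∞` kernel norm under linear substitutions of the fields

Topic `MathematicalPhysics/QuantumLattice`; the weighted companion of `GrassmannKernelYoung.lean`
(`sum_filter_norm_transform_le`: the multi-leg transform `K ↦ (X' ↦ Σ_X (∏ᵢ Mf (X'ᵢ) (Xᵢ)) K X)` costs a row
sum on the pinned leg and a column sum on each summed leg).  When input and output labels carry POSITIONS in a
common set `Λ` (`π : Γ → Λ`, `π' : Γ' → Λ`; think of sector or derived-field legs sitting at space-time points)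
and `wt` is a tree weight on `Finset Λ` (`SubmultiplicativeTreeWeight.lean`), the weight of the output positions
is dominated by the weight of the input positions times one pair weight per leg,
`wt(π' X') ≤ wt(π X) ∏ᵢ wt{π'(X'ᵢ), π(Xᵢ)}` (`IsTreeWeight.wt_image_le_mul_prod_pair`), so the weighted pinned
sums of the transform are bounded by the weighted norm of `K` with the matrix entries weighted by the pair weights:

* `IsTreeWeight.wt_union_biUnion_pair_le`, `IsTreeWeight.wt_image_le_mul_prod_pair` (joining legs one by one);
* **`sum_filter_wt_norm_transform_le`** — in degree `m + 1`, one output leg pinned,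
  `Σ_{X' : X'_p = w'} wt(π' X') ‖Σ_X (∏ᵢ Mf X'ᵢ Xᵢ) K X‖ ≤ cr · cc^m · N_K`, where `cr`, `cc` bound the row and column
  sums of `‖Mf y' x‖ wt{π' y', π x}` and `N_K` the `wt`-weighted pinned sums of `K`
  (Benfatto–Giuliani–Mastropietro 2006, (2.71a)/(2.82) with the decay bookkeeping of §3);
* **`sum_filter_wt_norm_kernel_map_le`** — the same for the kernels of `map f F` (`kernel_map`).

Everything is proved; no definitions (the weighted kernel and matrix are written inline), no named facts.

## Sources

G. Benfatto, A. Giuliani, V. Mastropietro, Ann. Henri Poincaré 7 (2006) 809–898, (2.70)–(2.71a), (2.82), §3 (3.2)–(3.8)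
[`BenfattoGiulianiMastropietro2006`]; M. Salmhofer, Commun. Math. Phys. 194 (1998) 249–295, §4.1 [`Salmhofer1998`].
Routine ("folklore": Young's inequality on a finite measure space).
-/

noncomputable section

namespace Literature.MathematicalPhysics.QuantumLattice

open GrassmannAlgebra Finset Literature.Probability.LatticeModels Literature.Probability.LatticeModels.BattleFederbush

variable {𝕜 : Type*} [RCLike 𝕜] {Γ Γ' Λ : Type*} [Fintype Γ] [DecidableEq Γ] [Fintype Γ'] [DecidableEq Γ'] [DecidableEq Λ]
variable {wt : Finset Λ → ℝ}

/-! ### Joining legs one by one -/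

omit [Fintype Γ] [DecidableEq Γ] [Fintype Γ'] [DecidableEq Γ'] in
/-- **Pairs hooked to a set**: if every `b i`, `i ∈ I`, lies in `S` then
`wt (S ∪ ⋃_{i ∈ I} {a i, b i}) ≤ wt S · ∏_{i ∈ I} wt {a i, b i}`. [folklore] -/
theorem _root_.Literature.Probability.LatticeModels.BattleFederbush.IsTreeWeight.wt_union_biUnion_pair_le {ι : Type*} [DecidableEq ι]
    (hwt : IsTreeWeight wt) (S : Finset Λ) (a b : ι → Λ) (I : Finset ι) (hb : ∀ i ∈ I, b i ∈ S) :
    wt (S ∪ I.biUnion fun i => {a i, b i}) ≤ wt S * ∏ i ∈ I, wt {a i, b i} := by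
  induction I using Finset.induction_on with
  | empty => simp
  | insert i I hi ih =>
    have hb' : ∀ j ∈ I, b j ∈ S := fun j hj => hb j (mem_insert_of_mem hj)
    rw [biUnion_insert, prod_insert hi,
      show S ∪ ({a i, b i} ∪ I.biUnion fun j => {a j, b j}) = (S ∪ I.biUnion fun j => {a j, b j}) ∪ {a i, b i} by
        rw [union_comm ({a i, b i} : Finset Λ), union_assoc]]
    have hov : ((S ∪ I.biUnion fun j => {a j, b j}) ∩ {a i, b i}).Nonempty :=
      ⟨b i, mem_inter.2 ⟨mem_union_left _ (hb i (mem_insert_self i I)), by simp⟩⟩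
    calc wt ((S ∪ I.biUnion fun j => {a j, b j}) ∪ {a i, b i})
        ≤ wt (S ∪ I.biUnion fun j => {a j, b j}) * wt {a i, b i} := hwt.union_le hov
      _ ≤ (wt S * ∏ j ∈ I, wt {a j, b j}) * wt {a i, b i} := mul_le_mul_of_nonneg_right (ih hb') (hwt.nonneg _)
      _ = wt S * (wt {a i, b i} * ∏ j ∈ I, wt {a j, b j}) := by ring

omit [Fintype Γ] [DecidableEq Γ] [Fintype Γ'] [DecidableEq Γ'] in
/-- **The weight of the output positions of a leg-by-leg substitution**: if every `b i` lies in `S` then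
`wt {a i : i} ≤ wt S · ∏ᵢ wt {a i, b i}`. [folklore] -/
theorem _root_.Literature.Probability.LatticeModels.BattleFederbush.IsTreeWeight.wt_image_le_mul_prod_pair {ι : Type*} [Fintype ι]
    [DecidableEq ι] (hwt : IsTreeWeight wt) (S : Finset Λ) (a b : ι → Λ) (hb : ∀ i, b i ∈ S) :
    wt (univ.image a) ≤ wt S * ∏ i, wt {a i, b i} := by
  have hsub : univ.image a ⊆ S ∪ univ.biUnion fun i => ({a i, b i} : Finset Λ) := by
    intro c hc
    obtain ⟨i, -, rfl⟩ := mem_image.1 hc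
    exact mem_union_right _ (mem_biUnion.2 ⟨i, mem_univ _, by simp⟩)
  exact (hwt.mono hsub).trans (hwt.wt_union_biUnion_pair_le S a b univ fun i _ => hb i)

/-! ### The weighted transform -/

/-- **Young's inequality for the weighted multi-leg transform, one leg pinned** (Benfatto–Giuliani–Mastropietro
2006, (2.71a)/(2.82) with §3): with positions `π`, `π'` in `Λ`, a tree weight `wt` on `Finset Λ`, row sums of
`‖Mf y' x‖ wt{π' y', π x}` at most `cr` and column sums at most `cc`, and `wt`-weighted pinned sums of `K` at most
`N_K`: in degree `m + 1`,
`Σ_{X' : X'_p = w'} wt(π' X') ‖Σ_X (∏ᵢ Mf X'ᵢ Xᵢ) K X‖ ≤ cr · cc^m · N_K`. [cite: BenfattoGiulianiMastropietro2006, (2.71a)] -/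
theorem sum_filter_wt_norm_transform_le (hwt : IsTreeWeight wt) (π : Γ → Λ) (π' : Γ' → Λ) {m : ℕ}
    (K : (Fin (m + 1) → Γ) → 𝕜) (Mf : Γ' → Γ → 𝕜) {cr cc : ℝ} (hcc0 : 0 ≤ cc)
    (hrow : ∀ y', ∑ x, ‖Mf y' x‖ * wt {π' y', π x} ≤ cr) (hcol : ∀ x, ∑ y', ‖Mf y' x‖ * wt {π' y', π x} ≤ cc)
    {NK : ℝ} (hNK0 : 0 ≤ NK)
    (hK : ∀ (q : Fin (m + 1)) (x : Γ), ∑ X ∈ univ.filter (fun X : Fin (m + 1) → Γ => X q = x), ‖K X‖ * wt ((univ.image X).image π) ≤ NK)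
    (p : Fin (m + 1)) (w' : Γ') :
    ∑ X' ∈ univ.filter (fun X' : Fin (m + 1) → Γ' => X' p = w'), wt ((univ.image X').image π') *
        ‖∑ X : Fin (m + 1) → Γ, (∏ i, Mf (X' i) (X i)) * K X‖ ≤ cr * cc ^ m * NK := by
  -- the weighted kernel and matrix, as nonnegative reals in `𝕜`
  set Kw : (Fin (m + 1) → Γ) → 𝕜 := fun X => ((‖K X‖ * wt ((univ.image X).image π) : ℝ) : 𝕜) with hKw
  set Mw : Γ' → Γ → 𝕜 := fun y' x => ((‖Mf y' x‖ * wt {π' y', π x} : ℝ) : 𝕜) with hMw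
  have hKw_norm : ∀ X, ‖Kw X‖ = ‖K X‖ * wt ((univ.image X).image π) := fun X => by
    rw [hKw]; dsimp only
    rw [RCLike.norm_ofReal, abs_of_nonneg (mul_nonneg (norm_nonneg _) (hwt.nonneg _))]
  have hMw_norm : ∀ y' x, ‖Mw y' x‖ = ‖Mf y' x‖ * wt {π' y', π x} := fun y' x => by
    rw [hMw]; dsimp only
    rw [RCLike.norm_ofReal, abs_of_nonneg (mul_nonneg (norm_nonneg _) (hwt.nonneg _))]
  -- the transform of the weighted data is a sum of nonnegative reals
  have hreal : ∀ X' : Fin (m + 1) → Γ', ∑ X : Fin (m + 1) → Γ, (∏ i, Mw (X' i) (X i)) * Kw X =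
      ((∑ X : Fin (m + 1) → Γ, (∏ i, ‖Mf (X' i) (X i)‖ * wt {π' (X' i), π (X i)}) * (‖K X‖ * wt ((univ.image X).image π)) : ℝ) : 𝕜) := by
    intro X'
    rw [hKw, hMw]
    push_cast
    rfl
  have hnonneg : ∀ X' : Fin (m + 1) → Γ', 0 ≤ ∑ X : Fin (m + 1) → Γ, (∏ i, ‖Mf (X' i) (X i)‖ * wt {π' (X' i), π (X i)}) *
      (‖K X‖ * wt ((univ.image X).image π)) := fun X' =>
    sum_nonneg fun X _ => mul_nonneg (prod_nonneg fun i _ => mul_nonneg (norm_nonneg _) (hwt.nonneg _))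
      (mul_nonneg (norm_nonneg _) (hwt.nonneg _))
  -- pointwise domination of the weighted term by the transform of the weighted data
  have hpt : ∀ X' : Fin (m + 1) → Γ', wt ((univ.image X').image π') * ‖∑ X : Fin (m + 1) → Γ, (∏ i, Mf (X' i) (X i)) * K X‖ ≤
      ‖∑ X : Fin (m + 1) → Γ, (∏ i, Mw (X' i) (X i)) * Kw X‖ := by
    intro X'
    rw [hreal, RCLike.norm_ofReal, abs_of_nonneg (hnonneg X')]
    refine (mul_le_mul_of_nonneg_left (norm_sum_le _ _) (hwt.nonneg _)).trans ?_
    rw [mul_sum]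
    refine sum_le_sum fun X _ => ?_
    have hw : wt ((univ.image X').image π') ≤ wt ((univ.image X).image π) * ∏ i, wt {π' (X' i), π (X i)} := by
      rw [image_image, image_image]
      exact hwt.wt_image_le_mul_prod_pair _ (π' ∘ X') (π ∘ X) fun i => mem_image_of_mem _ (mem_univ i)
    rw [norm_mul, norm_prod]
    calc wt ((univ.image X').image π') * ((∏ i, ‖Mf (X' i) (X i)‖) * ‖K X‖)
        ≤ (wt ((univ.image X).image π) * ∏ i, wt {π' (X' i), π (X i)}) * ((∏ i, ‖Mf (X' i) (X i)‖) * ‖K X‖) :=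
          mul_le_mul_of_nonneg_right hw (mul_nonneg (prod_nonneg fun i _ => norm_nonneg _) (norm_nonneg _))
      _ = (∏ i, ‖Mf (X' i) (X i)‖ * wt {π' (X' i), π (X i)}) * (‖K X‖ * wt ((univ.image X).image π)) := by
          rw [prod_mul_distrib]; ring
  -- the unweighted inequality for the weighted data
  have hrow' : ∀ y', ∑ x, ‖Mw y' x‖ ≤ cr := fun y' => by simp only [hMw_norm]; exact hrow y'
  have hcol' : ∀ x, ∑ y', ‖Mw y' x‖ ≤ cc := fun x => by simp only [hMw_norm]; exact hcol x
  have hKw_le : kernelNorm 1 (m + 1) Kw ≤ NK :=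
    kernelNorm_succ_le_of_forall 1 m Kw hNK0 fun q x => by
      rw [one_pow, one_mul]; simp only [hKw_norm]; exact hK q x
  have h := sum_filter_norm_transform_le Kw Mw hcc0 hrow' hcol' zero_le_one p w'
  rw [one_pow, one_mul] at h
  calc ∑ X' ∈ univ.filter (fun X' : Fin (m + 1) → Γ' => X' p = w'), wt ((univ.image X').image π') *
          ‖∑ X : Fin (m + 1) → Γ, (∏ i, Mf (X' i) (X i)) * K X‖
      ≤ ∑ X' ∈ univ.filter (fun X' : Fin (m + 1) → Γ' => X' p = w'), ‖∑ X : Fin (m + 1) → Γ, (∏ i, Mw (X' i) (X i)) * Kw X‖ :=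
        sum_le_sum fun X' _ => hpt X'
    _ ≤ cr * cc ^ m * kernelNorm 1 (m + 1) Kw := h
    _ ≤ cr * cc ^ m * NK := by
        have hcr0 : 0 ≤ cr := le_trans (sum_nonneg fun x _ => mul_nonneg (norm_nonneg _) (hwt.nonneg _)) (hrow w')
        exact mul_le_mul_of_nonneg_left hKw_le (mul_nonneg hcr0 (pow_nonneg hcc0 _))

variable [Algebra ℚ 𝕜]

/-- **Substituting the legs costs one weighted `L¹` norm per leg, with decay** (Benfatto–Giuliani–Mastropietro
2006, (2.71a)/(2.82) with §3): for a linear substitution `f` of the generators with matrix `M = toMatrix' f`,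
positions `π`, `π'` and a tree weight `wt`: in degree `m + 1`, one output leg pinned,
`Σ_{X' : X'_p = w'} wt(π' X') ‖kernel (map f F) (m+1) X'‖ ≤ cr · cc^m · N`, where `cr`, `cc` bound the row and column sums of
`‖M y' x‖ wt{π' y', π x}` and `N` the `wt`-weighted pinned sums of `kernel F (m+1)`. [cite: BenfattoGiulianiMastropietro2006, (2.71a)] -/
theorem sum_filter_wt_norm_kernel_map_le (hwt : IsTreeWeight wt) (π : Γ → Λ) (π' : Γ' → Λ) (f : (Γ → 𝕜) →ₗ[𝕜] (Γ' → 𝕜))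
    {cr cc : ℝ} (hcc0 : 0 ≤ cc)
    (hrow : ∀ y', ∑ x, ‖LinearMap.toMatrix' f y' x‖ * wt {π' y', π x} ≤ cr)
    (hcol : ∀ x, ∑ y', ‖LinearMap.toMatrix' f y' x‖ * wt {π' y', π x} ≤ cc)
    (F : GrassmannAlgebra 𝕜 Γ) (m : ℕ) {N : ℝ} (hN0 : 0 ≤ N)
    (hN : ∀ (q : Fin (m + 1)) (x : Γ), ∑ X ∈ univ.filter (fun X : Fin (m + 1) → Γ => X q = x),
      ‖kernel 𝕜 F (m + 1) X‖ * wt ((univ.image X).image π) ≤ N)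
    (p : Fin (m + 1)) (w' : Γ') :
    ∑ X' ∈ univ.filter (fun X' : Fin (m + 1) → Γ' => X' p = w'), wt ((univ.image X').image π') *
        ‖kernel 𝕜 (ExteriorAlgebra.map f F) (m + 1) X'‖ ≤ cr * cc ^ m * N := by
  simp only [kernel_map]
  exact sum_filter_wt_norm_transform_le hwt π π' _ _ hcc0 hrow hcol hN0 hN p w'

end Literature.MathematicalPhysics.QuantumLattice
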